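import Summits.QuantumFields.YangMills.Theorems.BalabanLadderUVOtherGroupsDefs
import Summits.QuantumFields.YangMills.Theorems.BalabanLadderUVSeamRecStubTransport
import Summits.QuantumFields.YangMills.Theorems.BalabanLadderUVSeamRecUnitTransfer
import Summits.QuantumFields.YangMills.Theorems.BalabanLadderUVSeamRecCeilingsTransfer
import Summits.QuantumFields.YangMills.Theorems.BalabanUVNodesClustersLeaf
import Literature.MathematicalPhysics.QuantumFieldTheory.Balaban1983to89.Node00.Record11
import Literature.LinearAlgebra.Matrix.SpecialUnitaryGroupNonisomorphism
import HarnessLib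

/-!
# Route `BalabanLadder`, crux `UVOtherGroups` (stmt-QuantumFields-19356): the `SU(N)` part in apex currency — kernels

Helper file (`--supports stmt-QuantumFields-19356`, fleet seat `ym-osasm-p2`, director-ym R136 (iii)) over the vocabulary
`Theorems/BalabanLadderUVOtherGroupsDefs.lean` (`UVSUN`, `CeilingsOfFloors`, `UVSeamSUN`, `UVNonSUN`).  Every theorem is proved; every
statement that is not proved is a named HYPOTHESIS; the two junctions with the spine route end in its LITERAL Props (D-0061):

* `uv_of_uvSUN : UVSUN → Theses.BalabanLadder.UV` — the pub-ymgap plan kernel `YMPlanD59.uv_of_uvSUN` («the group step contains the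
  SU(2) crux») against the tree: `UVSUN` at `N = 2` IS the spine's rung-R4 leaf (`YMDAG.UVSplit.uvD59_two_iff`); `uvSUN_iff` splits
  `UVSUN ↔ UV ∧ (∀ N ≥ 3, UVD59 N)`.
* `ceilingsOfFloors_iff_of_continuousMulEquiv` — D0 ISO-TRANSPORT: `CeilingsOfFloors` is invariant under topological-group isomorphisms of
  compact groups (Wilson's torus measures correspond under `U ↦ e ∘ U` by Haar uniqueness; the landed `UVSeamRec.Transport.lowerBounds_pull_iff`
  ∕ `momentBounds6_pull_iff` of `Theorems/BalabanLadderUVSeamRecStubTransport.lean`), hence the `SU(N)` seam stated AT the matrix group serves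
  every `G ≃ₜ* SU(N)` (`ceilingsOfFloors_of_uvSeamSUN`).
* `uvOtherGroups_of_split : UVSUN → UVSeamSUN → UVNonSUN → Theses.BalabanLadder.UVOtherGroups` — THE SPLIT of the residual leg into its
  `SU(N)`-typable part (apex package per `SU(N)` + the `SU(N)` seam) and the untypable non-`SU(N)` residual; `uvOtherGroups_of_split₃` uses
  of `UVSUN` only `N ≥ 3`; `uvNonSUN_of_uvOtherGroups` is the converse on the residual side; `uvOtherGroups_iff_ceilingsOfFloors` reads the
  leg in the `CeilingsOfFloors` vocabulary (`Iff.rfl`).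
* `yangMills_of_split` — the route's deciding theorem `Theses.BalabanLadder.closes` with the split substituted:
  `UVSUN → UVSeamRec → NT → IR → ROT → UVSeamSUN → UVNonSUN → YangMills` (the `UV` slot is fed by `uv_of_uvSUN`).

HONEST FRAMING: knits of a CONDITIONAL chain — nothing of Bałaban's programme, no seam and no residual is asserted or discharged here;
the hypotheses `UVSUN`, `UVSeamSUN`, `UVNonSUN` (and the spine's `UVSeamRec`, `NT`, `IR`, `ROT`) are the entire open content.  Not a gap, not Clay.
Refs: T. Bałaban, Commun. Math. Phys. 109 (1987) 249, Thm 2 («d = 4, G = SU(2)», remarks on general G); Bröcker–tom Dieck 1985 III (4.1);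
folklore (Haar measure is transported along continuous isomorphisms of compact groups).
-/

set_option autoImplicit false

noncomputable section

open MeasureTheory Filter Topology
open Literature.MathematicalPhysics.QuantumFieldTheory
open Summit.QuantumFields.YangMills.Cruxes.OSLegsFromFemtoAndGap.DlrCollarTransfer
open Summit.QuantumFields.YangMills.Cruxes.UVSeamRec.Transport

namespace Summit.QuantumFields.YangMills.Theorems.UVOtherGroups

/-! ## §1 Apex currency: `UVSUN` against the spine's leaf `UV` -/

/-- **The plan kernel `YMPlanD59.uv_of_uvSUN` against the tree: the `SU(N)` group step contains the `SU(2)` crux.**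
`UVSUN → Theses.BalabanLadder.UV` (item stmt-QuantumFields-19351), by `N = 2` and Track A's tether `YMDAG.UVSplit.uvD59_two_iff`. -/
theorem uv_of_uvSUN (h : UVSUN) : Summit.QuantumFields.YangMills.Theses.BalabanLadder.UV :=
  YMDAG.UVSplit.uvD59_two_iff.1 (h 2 le_rfl)

/-- `UVSUN` splits as the spine's leaf `UV` (the `N = 2` instance) and the apex package for every `SU(N)`, `N ≥ 3` — the part the
residual leg `UVOtherGroups` consumes (`uvOtherGroups_of_split₃`). -/
theorem uvSUN_iff :
    UVSUN ↔ Summit.QuantumFields.YangMills.Theses.BalabanLadder.UV ∧ ∀ (N : ℕ) [NeZero N], 3 ≤ N → YMDAG.UVSplit.UVD59 N := by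
  constructor
  · exact fun h => ⟨uv_of_uvSUN h, fun N _ hN => h N (by omega)⟩
  · rintro ⟨hUV, h3⟩ N _ hN
    rcases Nat.lt_or_ge N 3 with hlt | hge
    · obtain rfl : N = 2 := by omega
      exact YMDAG.UVSplit.uvD59_two_iff.2 hUV
    · exact h3 N hge

/-! ## §2 D0 iso-transport of the seam shape -/

section Transport

variable {G H : Type} [Group G] [TopologicalSpace G] [IsTopologicalGroup G] [CompactSpace G]
  [MeasurableSpace G] [BorelSpace G]
  [Group H] [TopologicalSpace H] [IsTopologicalGroup H] [CompactSpace H]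
  [MeasurableSpace H] [BorelSpace H]

/-- **`CeilingsOfFloors` descends along a topological-group isomorphism `e : G ≃ₜ* H` of compact groups**: a lattice representation
`r` of `G` is the pull-back along `e.symm` of the representation `r.ρ ∘ e.symm` of `H`, with the SAME floors and ceilings in every
unit (`lowerBounds_pull_iff`, `momentBounds6_pull_iff`: Haar uniqueness). -/
theorem ceilingsOfFloors_of_continuousMulEquiv (e : G ≃ₜ* H) (h : CeilingsOfFloors H) : CeilingsOfFloors G := by
  intro r a ha ha0 hlb
  have hlb' : LowerBounds H (pull e.symm r) a := (lowerBounds_pull_iff e.symm r a).2 hlb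
  exact (momentBounds6_pull_iff e.symm r a).1 (h (pull e.symm r) a ha ha0 hlb')

/-- **`CeilingsOfFloors` is invariant under topological-group isomorphisms of compact groups.** -/
theorem ceilingsOfFloors_iff_of_continuousMulEquiv (e : G ≃ₜ* H) : CeilingsOfFloors G ↔ CeilingsOfFloors H :=
  ⟨ceilingsOfFloors_of_continuousMulEquiv e.symm, ceilingsOfFloors_of_continuousMulEquiv e⟩

end Transport

/-- **The `SU(N)`-class form of the `SU(N)` seam**: under `UVSeamSUN`, for `N ≥ 3` with the apex package at `SU(N)`, every compact
group `G ≃ₜ* SU(N)` (any Borel structure) has `CeilingsOfFloors G`. -/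
theorem ceilingsOfFloors_of_uvSeamSUN (hSeam : UVSeamSUN) {N : ℕ} [NeZero N] (hN : 3 ≤ N) (hD : YMDAG.UVSplit.UVD59 N)
    (G : Type) [Group G] [TopologicalSpace G] [IsTopologicalGroup G] [CompactSpace G] [MeasurableSpace G] [BorelSpace G]
    (e : G ≃ₜ* Matrix.specialUnitaryGroup (Fin N) ℂ) : CeilingsOfFloors G :=
  ceilingsOfFloors_of_continuousMulEquiv e (hSeam N hN hD)

/-! ## §3 The split of the residual leg `UVOtherGroups` -/

/-- The leg read in the `CeilingsOfFloors` vocabulary (definitional, `Iff.rfl`): for every compact simple `G` not isomorphic to `SU(2)`,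
`CeilingsOfFloors G` over the Borel σ-algebra. -/
theorem uvOtherGroups_iff_ceilingsOfFloors :
    Summit.QuantumFields.YangMills.Theses.BalabanLadder.UVOtherGroups ↔
      ∀ (G : Type) [Group G] [TopologicalSpace G] [IsTopologicalGroup G] [CompactSpace G],
        IsCompactSimpleLieGroup G → IsEmpty (G ≃ₜ* Matrix.specialUnitaryGroup (Fin 2) ℂ) →
        letI : MeasurableSpace G := borel G; haveI : BorelSpace G := ⟨rfl⟩; CeilingsOfFloors G :=
  Iff.rfl

/-- **THE SPLIT, sharp form**: the apex package for every `SU(N)`, `N ≥ 3`, the `SU(N)` seam and the non-`SU(N)` residual imply the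
residual leg `Theses.BalabanLadder.UVOtherGroups` (item stmt-QuantumFields-19356).  Proof: a compact simple `G ≄ SU(2)` either admits
some `e : G ≃ₜ* SU(N)` — then `N ≥ 3` by the leg's guard and the seam at `SU(N)` descends along `e` — or admits none, which is the
residual's hypothesis. -/
theorem uvOtherGroups_of_split₃ (hSUN₃ : ∀ (N : ℕ) [NeZero N], 3 ≤ N → YMDAG.UVSplit.UVD59 N) (hSeam : UVSeamSUN)
    (hNon : UVNonSUN) : Summit.QuantumFields.YangMills.Theses.BalabanLadder.UVOtherGroups := by
  intro G _ _ _ _ hG h2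
  letI : MeasurableSpace G := borel G
  haveI : BorelSpace G := ⟨rfl⟩
  by_cases hex : ∃ N : ℕ, 2 ≤ N ∧ Nonempty (G ≃ₜ* Matrix.specialUnitaryGroup (Fin N) ℂ)
  · obtain ⟨N, hN2, ⟨e⟩⟩ := hex
    have hN3 : 3 ≤ N := by
      by_contra hlt
      obtain rfl : N = 2 := by omega
      exact h2.false e
    haveI : NeZero N := ⟨by omega⟩
    exact ceilingsOfFloors_of_uvSeamSUN hSeam hN3 (hSUN₃ N hN3) G e
  · exact hNon G hG (fun N hN => ⟨fun e => hex ⟨N, hN, ⟨e⟩⟩⟩)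

/-- **THE SPLIT**: `UVSUN → UVSeamSUN → UVNonSUN → Theses.BalabanLadder.UVOtherGroups` — the `SU(N)`-typable part of the residual leg
(Bałaban's apex package per `SU(N)` in apex currency + the `SU(N)` seam) split off from the untypable non-`SU(N)` residual by a
kernel-checked implication ending in the spine route's literal Prop. -/
theorem uvOtherGroups_of_split (hSUN : UVSUN) (hSeam : UVSeamSUN) (hNon : UVNonSUN) :
    Summit.QuantumFields.YangMills.Theses.BalabanLadder.UVOtherGroups :=
  uvOtherGroups_of_split₃ (fun N _ hN => hSUN N (by omega)) hSeam hNon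

/-- **Converse on the residual side**: the leg contains the non-`SU(N)` residual (a group admitting no `G ≃ₜ* SU(N)`, `N ≥ 2`, admits in
particular none onto `SU(2)`). -/
theorem uvNonSUN_of_uvOtherGroups (h : Summit.QuantumFields.YangMills.Theses.BalabanLadder.UVOtherGroups) : UVNonSUN :=
  fun G _ _ _ _ hG hno => h G hG (hno 2 le_rfl)

/-! ## §4 The route's deciding theorem with the split substituted -/

/-- **`closes` through the split**: Bałaban's apex package for every `SU(N)` (`UVSUN`, feeding the spine's `UV` slot by `uv_of_uvSUN`
and the residual leg by `uvOtherGroups_of_split`), the spine's `UVSeamRec`, `NT`, `IR`, `ROT`, the `SU(N)` seam and the non-`SU(N)`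
residual imply the summit conjunct `YangMills` — by the route's own deciding theorem `Theses.BalabanLadder.closes`.  Conditional on all
seven hypotheses; nothing is discharged. -/
theorem yangMills_of_split (hSUN : UVSUN) (hSeamRec : Summit.QuantumFields.YangMills.Theses.BalabanLadder.UVSeamRec)
    (hNT : Summit.QuantumFields.YangMills.Theses.BalabanLadder.NT) (hIR : Summit.QuantumFields.YangMills.Theses.BalabanLadder.IR)
    (hROT : Summit.QuantumFields.YangMills.Theses.BalabanLadder.ROT) (hSeam : UVSeamSUN) (hNon : UVNonSUN) : YangMills :=
  Summit.QuantumFields.YangMills.Theses.BalabanLadder.closes (uv_of_uvSUN hSUN) hSeamRec hNT hIR hROT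
    (uvOtherGroups_of_split hSUN hSeam hNon)

/-! ## §5 `UVSUN` at Track A's resolution: the record chain at `SU(N)`

Track A's detail route `BalabanUVNodes` (`Theses/BalabanUVNodes.lean`, deciding theorem `closes` authored 2026-08-26T12:59Z) files the
apex package at `N = 2` as FOUR items over NODE 00's Stage-11 record predicate `Node00.IsRecordOfRecord₁₁C F 2`: inhabitation of the
record class · (B) + the non-vacuity window at some record · endpoint existence given (B) + window · the hybrid-NE7 spine given (B) + END.
Every tree object in those items is typed at `SU(N)` for every `N ≥ 1` (`FiniteEpsData F SU(N)`, `Node00.IsRecordOfRecord₁₁C F N`,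
`Node00.isDatumOfRecord₀_of_isRecordOfRecord₁₁C`), so the same four statements with `2 ↦ N` and the same six-line proof give
`YMDAG.UVSplit.UVD59 N`: the `SU(N)` part of `UVSUN` is typable TODAY at Track A's resolution.  Stated over an ARBITRARY record predicate
`Rec` (the one property used: a record's datum is a Stage-0 datum of record), then pinned at Stage 11; at `N = 2` the four hypotheses
of `uvD59_of_recordChain₁₁C` are verbatim the bodies of the items `Record11Inhabited`, `StabilityBAtRecordR11e`, `EndpointGivenBR11`,
`SpineGivenEndpointR11` and its proof is that route's `closes` (not imported here: the detail route's items are re-staged per NODE 00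
record stage, the spine's leaf is not). -/

section RecordChain

open Literature.MathematicalPhysics.QuantumFieldTheory.Balaban1983to89
open Literature.MathematicalPhysics.QuantumFieldTheory.Balaban1983to89.T4Continuum

variable {N : ℕ} [NeZero N]

/-- **Track A's `closes` at `SU(N)`, over an arbitrary record predicate `Rec`** whose records are Stage-0 data of record: inhabitation ·
(B) + window at some record · END given (B) + window · hybrid-NE7 spine given (B) + END ⟹ `YMDAG.UVSplit.UVD59 N`. -/
theorem uvD59_of_recordChain (Rec : YMDAG.UVSplit.RecordPred N)
    (hRec : ∀ (F : T4Family) (D : FiniteEpsData F (Matrix.specialUnitaryGroup (Fin N) ℂ)) (w : DagBinding.WorldP),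
      Rec F D w → Node00.IsDatumOfRecord₀ F N D)
    (h0 : ∀ F : T4Family, ∃ (D : FiniteEpsData F (Matrix.specialUnitaryGroup (Fin N) ℂ)) (w : DagBinding.WorldP), Rec F D w)
    (h1 : ∀ F : T4Family, (∃ (D : FiniteEpsData F (Matrix.specialUnitaryGroup (Fin N) ℂ)) (w : DagBinding.WorldP), Rec F D w) →
      ∃ (D : FiniteEpsData F (Matrix.specialUnitaryGroup (Fin N) ℂ)) (w : DagBinding.WorldP), Rec F D w ∧
        B16.EndStatementBPrinted D.C ∧ ∃ γ₁ : ℝ, 0 < γ₁ ∧ ∀ γ : ℝ, 0 < γ → γ ≤ γ₁ →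
          ∃ P : B12.RunParams, 1 ≤ P.K ∧ (D.C P).flow.InInterval γ P.K)
    (h2 : ∀ (F : T4Family) (D : FiniteEpsData F (Matrix.specialUnitaryGroup (Fin N) ℂ)) (w : DagBinding.WorldP), Rec F D w →
      B16.EndStatementBPrinted D.C → (∃ γ₁ : ℝ, 0 < γ₁ ∧ ∀ γ : ℝ, 0 < γ → γ ≤ γ₁ →
        ∃ P : B12.RunParams, 1 ≤ P.K ∧ (D.C P).flow.InInterval γ P.K) → DagBinding.EndpointExistence D.C.toB12)
    (h3 : ∀ (F : T4Family) (D : FiniteEpsData F (Matrix.specialUnitaryGroup (Fin N) ℂ)) (w : DagBinding.WorldP), Rec F D w →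
      B16.EndStatementBPrinted D.C → DagBinding.EndpointExistence D.C.toB12 →
        T4ApexHybrid.HybridNE7Under D (DagBinding.EndpointExistence D.C.toB12)) :
    YMDAG.UVSplit.UVD59 N := by
  intro F
  obtain ⟨D, w, hR, hb, hwin⟩ := h1 F (h0 F)
  have hend : DagBinding.EndpointExistence D.C.toB12 := h2 F D w hR hb hwin
  exact ⟨D, hRec F D w hR, hb, hend, h3 F D w hR hb hend⟩

/-- **Track A's `closes` at `SU(N)`, Stage 11**: the four items of route `BalabanUVNodes` with `SU(2) ↦ SU(N)` (record predicate
`Node00.IsRecordOfRecord₁₁C F N`; its records are Stage-0 data of record by `Node00.isDatumOfRecord₀_of_isRecordOfRecord₁₁C`) imply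
`YMDAG.UVSplit.UVD59 N` — for EVERY `N`; with `N ≥ 2` ranging, the antecedent of `UVSUN` item by item. -/
theorem uvD59_of_recordChain₁₁C
    (h0 : ∀ F : T4Family, ∃ (D : FiniteEpsData F (Matrix.specialUnitaryGroup (Fin N) ℂ)) (w : DagBinding.WorldP),
      Node00.IsRecordOfRecord₁₁C F N D w)
    (h1 : ∀ F : T4Family, (∃ (D : FiniteEpsData F (Matrix.specialUnitaryGroup (Fin N) ℂ)) (w : DagBinding.WorldP),
        Node00.IsRecordOfRecord₁₁C F N D w) →
      ∃ (D : FiniteEpsData F (Matrix.specialUnitaryGroup (Fin N) ℂ)) (w : DagBinding.WorldP), Node00.IsRecordOfRecord₁₁C F N D w ∧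
        B16.EndStatementBPrinted D.C ∧ ∃ γ₁ : ℝ, 0 < γ₁ ∧ ∀ γ : ℝ, 0 < γ → γ ≤ γ₁ →
          ∃ P : B12.RunParams, 1 ≤ P.K ∧ (D.C P).flow.InInterval γ P.K)
    (h2 : ∀ (F : T4Family) (D : FiniteEpsData F (Matrix.specialUnitaryGroup (Fin N) ℂ)) (w : DagBinding.WorldP),
      Node00.IsRecordOfRecord₁₁C F N D w → B16.EndStatementBPrinted D.C → (∃ γ₁ : ℝ, 0 < γ₁ ∧ ∀ γ : ℝ, 0 < γ → γ ≤ γ₁ →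
        ∃ P : B12.RunParams, 1 ≤ P.K ∧ (D.C P).flow.InInterval γ P.K) → DagBinding.EndpointExistence D.C.toB12)
    (h3 : ∀ (F : T4Family) (D : FiniteEpsData F (Matrix.specialUnitaryGroup (Fin N) ℂ)) (w : DagBinding.WorldP),
      Node00.IsRecordOfRecord₁₁C F N D w → B16.EndStatementBPrinted D.C → DagBinding.EndpointExistence D.C.toB12 →
        T4ApexHybrid.HybridNE7Under D (DagBinding.EndpointExistence D.C.toB12)) :
    YMDAG.UVSplit.UVD59 N :=
  uvD59_of_recordChain (fun F D w => Node00.IsRecordOfRecord₁₁C F N D w)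
    (fun _ _ _ hR => Node00.isDatumOfRecord₀_of_isRecordOfRecord₁₁C hR) h0 h1 h2 h3

end RecordChain

/-! ## §6 The WITNESS-form split (appended 2026-08-26; candidate shape `UVSeamWitnessSUN` of the Defs file §3, owner's ∕ planner's choice)

The `SU(N)` seam in witness form — apex at `SU(N)` ⇒ ONE representation and ONE unit carrying floors ∧ ceilings, the `SU(N)` twin of the
spine's `UVSeamRec` — has no over-reach in the representation variable and composes into the summit conjunct through the bridge
`Y2Bridge.yangMills_of_legs` exactly as `closes`' first branch does for the `SU(2)` class: `yangMills_of_witnessSplit`.  The spine's `NT` is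
then consumed only for the non-`SU(N)` residual class. -/

section Witness

variable {G H : Type} [Group G] [TopologicalSpace G] [IsTopologicalGroup G] [CompactSpace G]
  [MeasurableSpace G] [BorelSpace G]
  [Group H] [TopologicalSpace H] [IsTopologicalGroup H] [CompactSpace H]
  [MeasurableSpace H] [BorelSpace H]

/-- **D0 iso-transport of a legs witness** (unit-generic form of the landed `UVSeamRec.Transport.transport_of_continuousMulEquiv`):
a representation of `H` and a positive unit `a → 0` carrying floors ∧ ceilings pull back along `e : G ≃ₜ* H` to the same for `G`. -/
theorem legsWitness_of_continuousMulEquiv (e : G ≃ₜ* H)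
    (h : ∃ (r : LatticeRep H) (a : ℝ → ℝ), (∀ β, 0 < a β) ∧ Tendsto a atTop (𝓝 0) ∧ LowerBounds H r a ∧ MomentBounds6 H r a) :
    ∃ (r : LatticeRep G) (a : ℝ → ℝ), (∀ β, 0 < a β) ∧ Tendsto a atTop (𝓝 0) ∧ LowerBounds G r a ∧ MomentBounds6 G r a := by
  obtain ⟨r₂, a, ha, ha0, hlb, hmb⟩ := h
  exact ⟨pull e r₂, a, ha, ha0, (lowerBounds_pull_iff e r₂ a).2 hlb, (momentBounds6_pull_iff e r₂ a).2 hmb⟩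

end Witness

/-- **Witness form ⇐ ∀-form + floors at `SU(N)`**: the `SU(N)` seam `UVSeamSUN` together with non-triviality floors at `SU(N)` in some
positive unit `a → 0` (the spine's `NT` read at the matrix group) gives `UVSeamWitnessSUN` — the witness form is the WEAKER statement. -/
theorem uvSeamWitnessSUN_of_uvSeamSUN (hSeam : UVSeamSUN)
    (hFloors : ∀ (N : ℕ) [NeZero N], 3 ≤ N →
      ∃ (r : LatticeRep (Matrix.specialUnitaryGroup (Fin N) ℂ)) (a : ℝ → ℝ), (∀ β, 0 < a β) ∧ Tendsto a atTop (𝓝 0) ∧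
        LowerBounds (Matrix.specialUnitaryGroup (Fin N) ℂ) r a) :
    UVSeamWitnessSUN := by
  intro N _ hN hD
  obtain ⟨r, a, ha, ha0, hlb⟩ := hFloors N hN
  exact ⟨r, a, ha, ha0, hlb, hSeam N hN hD r a ha ha0 hlb⟩

/-- **`YangMills` through the witness split** (the bridge `Y2Bridge.yangMills_of_legs`, three classes of compact simple `G`):
`G ≃ₜ* SU(2)` — the spine's `UVSeamRec` at the unit of record (fed `UV` by `uv_of_uvSUN`; unit positive and `→ 0` by the landed
`UnitTransfer.uRec_pos` ∕ `tendsto_uRec`); `G ≃ₜ* SU(N)`, `N ≥ 3` — the witness-form seam at `SU(N)` under `UVSUN`, transported along the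
isomorphism (`legsWitness_of_continuousMulEquiv`); no `SU(N)` at all — the spine's `NT` witness and the residual `UVNonSUN`; then `IR` and
`ROT` at the witness.  Conditional on all seven hypotheses; nothing is discharged; not a route (the spine's `closes` is unchanged). -/
theorem yangMills_of_witnessSplit (hSUN : UVSUN) (hSeamRec : Summit.QuantumFields.YangMills.Theses.BalabanLadder.UVSeamRec)
    (hWit : UVSeamWitnessSUN) (hNT : Summit.QuantumFields.YangMills.Theses.BalabanLadder.NT) (hNon : UVNonSUN)
    (hIR : Summit.QuantumFields.YangMills.Theses.BalabanLadder.IR) (hROT : Summit.QuantumFields.YangMills.Theses.BalabanLadder.ROT) :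
    YangMills := by
  refine Summit.QuantumFields.YangMills.Cruxes.OSLegsAtWeakCouplingC.Y2Bridge.yangMills_of_legs ?_
  intro G _ _ _ _ hG
  letI : MeasurableSpace G := borel G
  haveI : BorelSpace G := ⟨rfl⟩
  have hu : ∀ β : ℝ, 0 < uRec β := Summit.QuantumFields.YangMills.Cruxes.UVSeamRec.UnitTransfer.uRec_pos
  have hu0 : Tendsto uRec atTop (𝓝 0) := Summit.QuantumFields.YangMills.Cruxes.UVSeamRec.UnitTransfer.tendsto_uRec
  by_cases hcl : Nonempty (G ≃ₜ* Matrix.specialUnitaryGroup (Fin 2) ℂ)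
  · obtain ⟨r, hlb, hmb⟩ := hSeamRec (uv_of_uvSUN hSUN) G hG hcl
    exact ⟨r, uRec, hu, hu0, hmb, hlb, hIR G hG r uRec hu hu0 hlb, hROT G hG r uRec hu hu0 hlb hmb⟩
  · by_cases hex : ∃ N : ℕ, 2 ≤ N ∧ Nonempty (G ≃ₜ* Matrix.specialUnitaryGroup (Fin N) ℂ)
    · obtain ⟨N, hN2, ⟨e⟩⟩ := hex
      have hN3 : 3 ≤ N := by
        by_contra hlt
        obtain rfl : N = 2 := by omega
        exact hcl ⟨e⟩
      haveI : NeZero N := ⟨by omega⟩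
      obtain ⟨r, a, ha, ha0, hlb, hmb⟩ := legsWitness_of_continuousMulEquiv e (hWit N hN3 (hSUN N (by omega)))
      exact ⟨r, a, ha, ha0, hmb, hlb, hIR G hG r a ha ha0 hlb, hROT G hG r a ha ha0 hlb hmb⟩
    · obtain ⟨r, a, ha, ha0, hlb⟩ := hNT G hG
      have hmb : MomentBounds6 G r a := hNon G hG (fun N hN => ⟨fun e => hex ⟨N, hN, ⟨e⟩⟩⟩) r a ha ha0 hlb
      exact ⟨r, a, ha, ha0, hmb, hlb, hIR G hG r a ha ha0 hlb, hROT G hG r a ha ha0 hlb hmb⟩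

/-! ## §7 The calibration window (W) of the ∀-shape, isolated (appended 2026-08-26)

The ∀-shape `CeilingsOfFloors G` («ceilings in EVERY unit carrying the floors») factors through ONE unit per representation: the landed
one-sided transfer `UVSeamRec.CeilingsTransfer.momentBounds6_of_eventually_le` (the plane-resolved ceilings see the unit only through the
collar-radius constraint `R · a β ≤ ℓ₄`, so they pass from a unit `u` to every unit `a` with `u ≤ c · a` eventually) reduces it to
(E0′ᵤ) ceilings at some unit `u_r` — Bałaban's own unit — and (W) every positive unit `a → 0` carrying the floors `LowerBounds G r a` is
eventually COARSER than `u_r` up to a constant.  (W) is the clustering-flavoured debt named in the route text of the banked `UVSeam`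
(«window a ≳ ξ⁻¹/K(ε)»; in units finer than the correlation length the floors die by clustering): it is isolated below as a hypothesis
SHAPE, per representation, so that a line for `UVSeamSUN` can file E0′ᵤ and (W) as separate stubs.  Nothing is asserted. -/

section Window

variable {G : Type} [Group G] [TopologicalSpace G] [IsTopologicalGroup G] [CompactSpace G]
  [MeasurableSpace G] [BorelSpace G]

/-- **`CeilingsOfFloors` from ceilings at ONE unit per representation + the window (W)**: if every lattice representation `r` of `G`
has a unit `u` with the plane-resolved ceilings `MomentBounds6 G r u` such that every positive unit `a → 0` carrying `LowerBounds G r a`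
satisfies `u ≤ c · a` eventually for some `c > 0`, then `CeilingsOfFloors G` (by `momentBounds6_of_eventually_le`). -/
theorem ceilingsOfFloors_of_unit_window
    (h : ∀ r : LatticeRep G, ∃ u : ℝ → ℝ, MomentBounds6 G r u ∧
      ∀ a : ℝ → ℝ, (∀ β, 0 < a β) → Tendsto a atTop (𝓝 0) → LowerBounds G r a →
        ∃ c : ℝ, 0 < c ∧ ∀ᶠ β in atTop, u β ≤ c * a β) :
    CeilingsOfFloors G := by
  intro r a ha ha0 hlb
  obtain ⟨u, hu, hW⟩ := h r
  obtain ⟨c, hc, hle⟩ := hW a ha ha0 hlb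
  exact Summit.QuantumFields.YangMills.Cruxes.UVSeamRec.CeilingsTransfer.momentBounds6_of_eventually_le r hc hle hu

end Window

/-- **The `SU(N)` seam from E0′ at one unit + the window, per `N ≥ 3`**: IF for every `N ≥ 3` the apex package at `SU(N)` yields, for
every lattice representation `r` of `SU(N)`, ceilings at SOME unit `u` (E0′ᵤ — intended: Bałaban's own unit, or the `SU(N)` two-loop
unit after the one-sided transfer) together with the window (W) «every unit carrying the floors of `r` is eventually coarser than `u`»,
THEN `UVSeamSUN`.  The two conjuncts are the two unprinted debts of the `SU(N)` seam, separated; the representation over-reach (∀ `r`)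
of the ∀-shape is still present in both (§3 of the Defs file). -/
theorem uvSeamSUN_of_unit_window
    (h : ∀ (N : ℕ) [NeZero N], 3 ≤ N → YMDAG.UVSplit.UVD59 N →
      ∀ r : LatticeRep (Matrix.specialUnitaryGroup (Fin N) ℂ), ∃ u : ℝ → ℝ,
        MomentBounds6 (Matrix.specialUnitaryGroup (Fin N) ℂ) r u ∧
        ∀ a : ℝ → ℝ, (∀ β, 0 < a β) → Tendsto a atTop (𝓝 0) → LowerBounds (Matrix.specialUnitaryGroup (Fin N) ℂ) r a →
          ∃ c : ℝ, 0 < c ∧ ∀ᶠ β in atTop, u β ≤ c * a β) :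
    UVSeamSUN :=
  fun N _ hN hD => ceilingsOfFloors_of_unit_window (h N hN hD)

/-! ## §8 The split is LOSSLESS modulo `IsCompactSimpleLieGroup SU(N)` (appended 2026-08-26)

Converse of §3 on the `SU(N)` side: the leg `UVOtherGroups` CONTAINS the ∀-shape `SU(N)` seam's conclusion `CeilingsOfFloors SU(N)` for
every `N ≥ 3` at which `SU(N)` is a compact simple Lie group — instantiate the leg at `G := SU(N)`; its guard `IsEmpty (SU(N) ≃ₜ* SU(2))`
holds for `N ≥ 3` by the centre (`Literature.LinearAlgebra.Matrix.isEmpty_continuousMulEquiv_specialUnitaryGroup_two`, Curtis VII §C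
Prop. 9: `Z(SU(n)) ≅ ℤ/n`, landed p456132).  So, modulo `IsCompactSimpleLieGroup SU(N)` (the tree's named UNPROVED fact
`isSimpleCompactGroup_specialUnitaryGroup` via `isCompactSimpleLieGroup_specialUnitaryGroup`), the leg is EQUIVALENT to
`(∀ N ≥ 3, CeilingsOfFloors SU(N)) ∧ UVNonSUN`: the representation over-reach and the window located in §3 of the Defs file and §7 are
the item's own, not artefacts of the split. -/

/-- **The leg gives the `SU(N)` seam's conclusion, `N ≥ 3`** (given that `SU(N)` is a compact simple Lie group): `CeilingsOfFloors SU(N)`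
over the tree's Borel structure — the leg at `G := SU(N)`, guard by `isEmpty_continuousMulEquiv_specialUnitaryGroup_two`. -/
theorem ceilingsOfFloors_sun_of_uvOtherGroups (h : Summit.QuantumFields.YangMills.Theses.BalabanLadder.UVOtherGroups) {N : ℕ}
    (hN : 3 ≤ N) (hG : IsCompactSimpleLieGroup (Matrix.specialUnitaryGroup (Fin N) ℂ)) :
    CeilingsOfFloors (Matrix.specialUnitaryGroup (Fin N) ℂ) :=
  h (Matrix.specialUnitaryGroup (Fin N) ℂ) hG
    (Literature.LinearAlgebra.Matrix.isEmpty_continuousMulEquiv_specialUnitaryGroup_two hN)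

/-- **The leg from unconditional `SU(N)` ceilings-of-floors and the residual** (the reverse direction of the equivalence; no apex
hypothesis): `(∀ N ≥ 3, CeilingsOfFloors SU(N)) → UVNonSUN → UVOtherGroups`. -/
theorem uvOtherGroups_of_ceilingsOfFloors_sun
    (hS : ∀ (N : ℕ) [NeZero N], 3 ≤ N → CeilingsOfFloors (Matrix.specialUnitaryGroup (Fin N) ℂ)) (hNon : UVNonSUN) :
    Summit.QuantumFields.YangMills.Theses.BalabanLadder.UVOtherGroups := by
  intro G _ _ _ _ hG h2
  letI : MeasurableSpace G := borel G
  haveI : BorelSpace G := ⟨rfl⟩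
  by_cases hex : ∃ N : ℕ, 2 ≤ N ∧ Nonempty (G ≃ₜ* Matrix.specialUnitaryGroup (Fin N) ℂ)
  · obtain ⟨N, hN2, ⟨e⟩⟩ := hex
    have hN3 : 3 ≤ N := by
      by_contra hlt
      obtain rfl : N = 2 := by omega
      exact h2.false e
    haveI : NeZero N := ⟨by omega⟩
    exact ceilingsOfFloors_of_continuousMulEquiv e (hS N hN3)
  · exact hNon G hG (fun N hN => ⟨fun e => hex ⟨N, hN, ⟨e⟩⟩⟩)

/-- **THE SPLIT IS LOSSLESS**: given that every `SU(N)`, `N ≥ 3`, is a compact simple Lie group, the residual leg `UVOtherGroups` is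
EQUIVALENT to «`CeilingsOfFloors SU(N)` for every `N ≥ 3`» ∧ «the non-`SU(N)` residual `UVNonSUN`». -/
theorem uvOtherGroups_iff_ceilingsOfFloors_sun_and_nonSUN
    (hGN : ∀ (N : ℕ), 3 ≤ N → IsCompactSimpleLieGroup (Matrix.specialUnitaryGroup (Fin N) ℂ)) :
    Summit.QuantumFields.YangMills.Theses.BalabanLadder.UVOtherGroups ↔
      (∀ (N : ℕ) [NeZero N], 3 ≤ N → CeilingsOfFloors (Matrix.specialUnitaryGroup (Fin N) ℂ)) ∧ UVNonSUN :=
  ⟨fun h => ⟨fun N _ hN => ceilingsOfFloors_sun_of_uvOtherGroups h hN (hGN N hN), uvNonSUN_of_uvOtherGroups h⟩,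
    fun h => uvOtherGroups_of_ceilingsOfFloors_sun h.1 h.2⟩

/-- **The same equivalence under the tree's named fact** `isSimpleCompactGroup_specialUnitaryGroup` (simplicity of `SU(n)`, `n ≥ 2`;
Bröcker–tom Dieck V (7.13), unproved in the tree), through `isCompactSimpleLieGroup_specialUnitaryGroup`.  CONDITIONAL on that fact. -/
theorem uvOtherGroups_iff_ceilingsOfFloors_sun_and_nonSUN_of_fact
    (hfact : Literature.MathematicalPhysics.QuantumLattice.isSimpleCompactGroup_specialUnitaryGroup.{0}) :
    Summit.QuantumFields.YangMills.Theses.BalabanLadder.UVOtherGroups ↔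
      (∀ (N : ℕ) [NeZero N], 3 ≤ N → CeilingsOfFloors (Matrix.specialUnitaryGroup (Fin N) ℂ)) ∧ UVNonSUN :=
  uvOtherGroups_iff_ceilingsOfFloors_sun_and_nonSUN fun _ hN =>
    isCompactSimpleLieGroup_specialUnitaryGroup hfact (by omega)

end Summit.QuantumFields.YangMills.Theorems.UVOtherGroups

end
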